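import Mathlib.LinearAlgebra.Eigenspace.Pi
import Summits.BirchSwinnertonDyer.BirchSwinnertonDyer.Theses.TameQuarticManinParity
import Literature.NumberTheory.EllipticCurves.NewformEigencharacter
import Literature.NumberTheory.EllipticCurves.NewformsOldNewGamma1Proofs
import HarnessLib

/-!
# Route `TameQuarticManinParity`: FIN34a `GammaOneNewformsFinite` (stmt-BirchSwinnertonDyer-23839) BY NAME —
# there are finitely many newforms on `Γ₁(M)` of any weight

Lead seat `cruxlead-stmt-BirchSwinnertonDyer-23367` (crux MS `TprimeIrrModThreeSaturation`, line `abelian-fixed-points`):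
FIN34a is one of the two finiteness leaves of LINE 34 (G34 `congruentNewformCarriesTorsionRep_of_everywhere`, p681685).
PROOF OVER LANDED THEOREMS, the `Γ₁` analogue of `linearIndependent_newforms0_holds` / `finite_newforms0_holds`
(no multiplicity one is used):
* the Hecke ring `𝕋_ℤ = ℤ[T_p, ⟨d⟩]` of `S_k(Γ₁(M))` is commutative (`mul_comm_of_mem_heckeRing1`), and a newform `f` is
  an eigenvector of every `T ∈ 𝕋_ℤ` with eigenvalue `θ_f(T) = a₁(T f)` (`IsNewform1.apply_eq_eigencharacter_smul`);
* **distinct newforms have distinct eigencharacters**: if `a₁(T f) = a₁(T g)` for all `T ∈ 𝕋_ℤ` then `a₁(T (f - g)) = 0`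
  for all `T`, whence `f = g` by the separation of `S_k(Γ₁(M))` by `a₁ ∘ 𝕋_ℤ`
  (`eq_zero_of_forall_heckeRing1_cuspCoeff_one`, Shimura 1971 Thm. 3.51);
* nonzero vectors in the joint eigenspaces of a commuting family attached to pairwise distinct characters are linearly
  independent (Mathlib `Module.End.independent_iInf_maxGenEigenspace_of_forall_mapsTo`, `iSupIndep.linearIndependent`),
  and a linearly independent subset of the finite-dimensional space `S_k(Γ₁(M))` (`finiteDimensional_cuspForm_gamma1`)
  is finite.
THEOREMS ONLY; no definition, no named fact, no `sorry`.  No summit is proved; BSD is NOT proved.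
-/

set_option autoImplicit false
-- D-0017: single-problem summit, so `Summit.BirchSwinnertonDyer.BirchSwinnertonDyer.…` repeats a namespace BY DESIGN.
set_option linter.dupNamespace false

noncomputable section

open scoped MatrixGroups ModularForm
open CongruenceSubgroup
open Literature.NumberTheory.EllipticCurves.ModularForms

namespace Summit.BirchSwinnertonDyer.BirchSwinnertonDyer.Theorems.TameQuarticManinParity

open Summit.BirchSwinnertonDyer.BirchSwinnertonDyer.Theses.TameQuarticManinParity

variable {M : ℕ} [NeZero M] {k : ℤ}

/-- **Distinct newforms on `Γ₁(M)` have distinct eigencharacters**: if `a₁(T f) = a₁(T g)` for every `T` in the Hecke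
ring `𝕋_ℤ`, then `f = g` (separation of `S_k(Γ₁(M))` by `a₁ ∘ 𝕋_ℤ`, Shimura 1971, Thm. 3.51).
[cite: Shimura1971, Thm. 3.51 (proof), p. 85] -/
theorem isNewform1_eq_of_forall_cuspCoeff_apply_eq {f g : CuspForm (Gamma1 M) k}
    (h : ∀ T ∈ heckeRing1 M k, cuspCoeff (T f) 1 = cuspCoeff (T g) 1) : f = g := by
  have h0 : f - g = 0 := eq_zero_of_forall_heckeRing1_cuspCoeff_one (f - g) fun T hT ↦ by
    rw [map_sub, cuspCoeff_sub_gamma1, h T hT, sub_self]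
  exact sub_eq_zero.mp h0

/-- **Independence of the joint generalised eigenspaces of the Hecke ring.** For distinct characters `χ : 𝕋_ℤ → ℂ` the
subspaces `⋂_{T ∈ 𝕋_ℤ} {v : (T - χ(T))^∞ v = 0}` of `S_k(Γ₁(M))` are independent — linear algebra for the commuting
family `𝕋_ℤ` (`mul_comm_of_mem_heckeRing1`; Mathlib `Module.End.independent_iInf_maxGenEigenspace_of_forall_mapsTo`).
[folklore] -/
theorem iSupIndep_iInf_maxGenEigenspace_heckeRing1 :
    iSupIndep fun χ : heckeRing1 M k → ℂ ↦
      ⨅ T : heckeRing1 M k, Module.End.maxGenEigenspace (T : Module.End ℂ (CuspForm (Gamma1 M) k)) (χ T) :=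
  Module.End.independent_iInf_maxGenEigenspace_of_forall_mapsTo
    (fun T : heckeRing1 M k ↦ (T : Module.End ℂ (CuspForm (Gamma1 M) k)))
    fun S T φ ↦ Module.End.mapsTo_maxGenEigenspace_of_comm
      (show Commute (T : Module.End ℂ (CuspForm (Gamma1 M) k)) (S : Module.End ℂ (CuspForm (Gamma1 M) k)) from
        mul_comm_of_mem_heckeRing1 T.2 S.2) φ

/-- A newform `f` lies in the joint (generalised) eigenspace of `𝕋_ℤ` for its own eigencharacter `θ_f`
(`T f = θ_f(T) f`). [folklore] -/
theorem isNewform1_mem_iInf_maxGenEigenspace {f : CuspForm (Gamma1 M) k} (hf : IsNewform1 f) :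
    f ∈ ⨅ T : heckeRing1 M k, Module.End.maxGenEigenspace (T : Module.End ℂ (CuspForm (Gamma1 M) k))
        (hf.eigencharacter T) := by
  refine (Submodule.mem_iInf _).mpr fun T ↦ Module.End.eigenspace_le_maxGenEigenspace ?_
  rw [Module.End.mem_eigenspace_iff]
  exact hf.apply_eq_eigencharacter_smul T

/-- A newform is nonzero (`a₁(f) = 1`). [folklore] -/
theorem isNewform1_ne_zero {f : CuspForm (Gamma1 M) k} (hf : IsNewform1 f) : f ≠ 0 := by
  intro h0
  have h1 := hf.cuspCoeff_one
  have hz := cuspCoeff_smul_gamma1 (0 : ℂ) (0 : CuspForm (Gamma1 M) k) 1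
  rw [zero_smul, zero_mul] at hz
  rw [h0, hz] at h1
  exact zero_ne_one h1

variable (M k) in
/-- **Newforms on `Γ₁(M)` are linearly independent** (Diamond–Shurman Thm. 5.8.2, proof; Li 1975 Thm. 3): they are nonzero
vectors in the joint eigenspaces of the commuting family `𝕋_ℤ` attached to pairwise distinct eigencharacters.
[cite: DiamondShurman2005, Thm. 5.8.2 (proof, p. 198)] -/
theorem linearIndepOn_newforms1 : LinearIndepOn ℂ id (newforms1 M k) := by
  have hind := (iSupIndep_iInf_maxGenEigenspace_heckeRing1 (M := M) (k := k)).comp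
    (f := fun f : newforms1 M k ↦ fun T : heckeRing1 M k ↦
      (show IsNewform1 (f : CuspForm (Gamma1 M) k) from f.2).eigencharacter T)
    (fun f g hfg ↦ Subtype.ext <|
      isNewform1_eq_of_forall_cuspCoeff_apply_eq fun T hT ↦ by
        have := congr_fun hfg ⟨T, hT⟩
        simpa only [IsNewform1.eigencharacter_apply] using this)
  exact hind.linearIndependent _
    (fun f ↦ isNewform1_mem_iInf_maxGenEigenspace (show IsNewform1 f.1 from f.2))
    (fun f ↦ isNewform1_ne_zero (show IsNewform1 f.1 from f.2))

/-- **FIN34a `GammaOneNewformsFinite` BY NAME** (stmt-BirchSwinnertonDyer-23839): for every level `M ≥ 1` and weight `k`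
the set of newforms in `S_k(Γ₁(M))` is finite — a linearly independent subset (`linearIndepOn_newforms1`) of the
finite-dimensional space `S_k(Γ₁(M))` (`finiteDimensional_cuspForm_gamma1`). [cite: DiamondShurman2005, Thm. 5.8.2] -/
theorem gammaOneNewformsFinite_proof : GammaOneNewformsFinite := by
  intro M _ k
  haveI := finiteDimensional_cuspForm_gamma1 M k
  exact (linearIndepOn_newforms1 M k).set_finite_of_isNoetherian

end Summit.BirchSwinnertonDyer.BirchSwinnertonDyer.Theorems.TameQuarticManinParity

end
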